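import Summits.QuantumAdvantage.QuantumAdvantage.Theorems.LinnikCubicClassGroupsDegreeOnePrimesEscapeFrobeniusWindowCoreZFR
import Summits.QuantumAdvantage.QuantumAdvantage.Theorems.LinnikCubicClassGroupsDegreeOnePrimesEscapeFrobeniusWindowDHNumerics
import Summits.QuantumAdvantage.QuantumAdvantage.Theorems.LinnikCubicClassGroupsDegreeOnePrimesEscapeFrobeniusWindow
import HarnessLib

/-!
# The Deuring-twisted window explicit formula with a prescribed zero-free region: the assembled core bound

Topic `Summits/QuantumAdvantage/QuantumAdvantage/Theorems`, cell B2b-1 (linnik-cubic), PART A (gen 17); helper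
toward the crux `DegreeOnePrimesEscape` (stmt-QuantumAdvantage-11543) of route `LinnikCubicClassGroups` — the
Deuring–Heilbronn-enhanced CHEBOTAREV DENSITY THEOREM IN SHORT INTERVALS.  HONEST FRAMING: the value of this file
is a THEOREM (kernel-checked lemmas) — NOT summit progress.

* `core_glue_le` — real-arithmetic glue (inequality form of `core_glue`);
* `frobWindow_core_dh` — `frobWindow_core_zfr` + `frobWindow_bookkeeping` + the junk absorption: with a zero-free
  constant `c_Z` off the exceptional segment up to height `T₁ = X^θ`, collar `ε = ε₀η`, and the junk bound
  `n₀·J ≤ (κc₁/2)Q^{−2}`, the Deuring-twisted window sum is within `(n₀(9/2)·2eD e^{−c_Z/(6θ)} + (κc₁/2)Q^{−2})·x·η`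
  of its main terms;
* `excSets_of_unique_zero` — the exceptional sets `Exc j` attached to the (unique, real) exceptional zero `β₁` and the
  identity `Σ_j c^j Σ_{ρ∈Exc j} m_j(ρ)F(−ρ) = (m_E(β₁) + Σ_j c^j m_j(β₁)) F(−β₁)`.
-/

noncomputable section

open Complex Real MeasureTheory Set Filter Topology NumberField NumberField.InfinitePlace IsDedekindDomain
open scoped NumberField nonZeroDivisors

namespace Summit.QuantumAdvantage.QuantumAdvantage.Theorems.DegreeOnePrimesEscape

open Literature.NumberTheory.LFunctions Literature.NumberTheory.LFunctions.NumberField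
  Literature.NumberTheory.LFunctions.EntireEF Literature.NumberTheory.LFunctions.WindowWeight
  Literature.NumberTheory.LFunctions.AbelianDensity

/-- Real-arithmetic glue (inequality form): `m(B + J) ≤ K x η` from `B + h J ≤ x η (9κ₁/2 + κ₂)`, `h ≥ 1`,
`m ≤ n₀`, `n₀ (9κ₁/2 + κ₂) x η ≤ K x η`. -/
theorem core_glue_le {m n₀ hN B J x η κ₁ κ₂ K : ℝ} (hm0 : 0 ≤ m) (hmn : m ≤ n₀) (hh1 : 1 ≤ hN)
    (hB : 0 ≤ B) (hJ : 0 ≤ J) (hbook : B + hN * J ≤ x * η * (9 / 2 * κ₁ + κ₂))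
    (hκ : n₀ * (9 / 2 * κ₁ + κ₂) * x * η ≤ K * x * η) :
    m * (B + J) ≤ K * x * η := by
  have h1 : J ≤ hN * J := by nlinarith
  have h2 : B + J ≤ x * η * (9 / 2 * κ₁ + κ₂) := by linarith
  have h3 : 0 ≤ B + J := by positivity
  calc m * (B + J) ≤ n₀ * (B + J) := mul_le_mul_of_nonneg_right hmn h3
    _ ≤ n₀ * (x * η * (9 / 2 * κ₁ + κ₂)) := mul_le_mul_of_nonneg_left h2 (hm0.trans hmn)
    _ = n₀ * (9 / 2 * κ₁ + κ₂) * x * η := by ring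
    _ ≤ K * x * η := hκ

set_option maxHeartbeats 3200000 in
/-- **The assembled core bound with a prescribed zero-free region** (see the module docstring). -/
theorem frobWindow_core_dh (n₀ : ℕ) (hn₀ : 1 < n₀) {b D a : ℝ} (hb : 0 < b) (hD : 0 < D) (ha : 1 ≤ a)
    (c : ℝ) {cZ : ℝ} (hcZ : 0 < cZ)
    {Al Cr M : ℝ} (hAl0 : 0 < Al)
    (hAl : ∀ (K : Type) [Field K] [NumberField K] (χ : ClassGroup (𝓞 K) →* ℂˣ) (t : ℝ),
      ‖logDeriv (classGroupLFunction K χ) (-1 / 2 + t * I)‖ ≤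
        Al * (Module.finrank ℚ K + 1) * (Real.log ((NumberField.discr K).natAbs : ℝ) + Real.log (|t| + 4)))
    (hCr0 : 0 < Cr)
    (hCr : ∀ (K : Type) [Field K] [NumberField K] (𝔪 : Ideal (𝓞 K))
      (ψ : HeightOneSpectrum (𝓞 K) → ℂ) (p : Finset {w : InfinitePlace K // IsReal w}),
      IsRayClassCharacter 𝔪 ψ → IsPrimitive 𝔪 ψ → IsSignType 𝔪 ψ p → 𝔪 ≠ ⊥ →
      ∀ (L L' : ℂ → ℂ), Differentiable ℂ L → (∀ s : ℂ, 1 < s.re → L s = rayClassLSeries 𝔪 ψ s) →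
        Differentiable ℂ L' → (∀ s : ℂ, 1 < s.re → L' s = rayClassLSeries 𝔪 (star ψ) s) →
      ∀ t : ℝ, ‖logDeriv L (-1 / 2 + t * I)‖ ≤
        Cr * (Module.finrank ℚ K + 1) * (Real.log (|(discr K : ℝ)| * (Ideal.absNorm 𝔪 : ℝ)) + Real.log (|t| + 4)))
    (hM : ∀ y : ℝ, |iteratedDeriv 1 Real.smoothTransition y| ≤ M ∧ |iteratedDeriv 2 Real.smoothTransition y| ≤ M)
    (hM1 : 1 ≤ M)
    (E N : Type) [Field E] [NumberField E] [Field N] [NumberField N] [Algebra E N]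
    (hNn : Module.finrank ℚ N = n₀)
    (hdens : ∀ (T : ℝ), 1 ≤ T → ∀ u : AddChar (Additive (ClassGroup (𝓞 N))) ℂ → Finset ℂ,
        (∀ ψ, ∀ ρ ∈ u ψ, famF N ψ ρ = 0 ∧ 1 / 4 ≤ ρ.re ∧ ρ.re < 1 ∧ |ρ.im| ≤ T) →
        ∀ α : ℝ, α ≤ 1 →
          ∑ ψ, ∑ ρ ∈ u ψ with α ≤ ρ.re, (famMult N ψ ρ : ℝ) ≤
            D * Real.exp (b * (a * Real.log (ThornerZaman.condQn N) + Real.log (T + 4))) ^ (1 - α))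
    (m : ℕ) (hm1 : 1 ≤ m) (hdeg : Module.finrank ℚ N = Module.finrank ℚ E * m)
    (𝔣 : ℕ → Ideal (𝓞 E)) (χ : ℕ → HeightOneSpectrum (𝓞 E) → ℂ)
    (p : ℕ → Finset {w : InfinitePlace E // w.IsReal}) (L L' : ℕ → ℂ → ℂ)
    (hdata : ∀ j, 𝔣 j ≠ ⊥ ∧ IsRayClassCharacter (𝔣 j) (χ j) ∧ IsPrimitive (𝔣 j) (χ j) ∧ IsSignType (𝔣 j) (χ j) (p j))
    (hnt : ∀ j ∈ Finset.Ico 1 m, ∃ v : HeightOneSpectrum (𝓞 E), ¬ 𝔣 j ≤ v.asIdeal ∧ χ j v ≠ 1)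
    (hL : ∀ j ∈ Finset.Ico 1 m, Differentiable ℂ (L j) ∧ ∀ s : ℂ, 1 < s.re → L j s = rayClassLSeries (𝔣 j) (χ j) s)
    (hL' : ∀ j ∈ Finset.Ico 1 m, Differentiable ℂ (L' j) ∧
      ∀ s : ℂ, 1 < s.re → L' j s = rayClassLSeries (𝔣 j) (star (χ j)) s)
    (hord : ∀ ρ : ℂ, analyticOrderNatAt (dedekindZeta₁ N) ρ =
        analyticOrderNatAt (dedekindZeta₁ E) ρ + ∑ j ∈ Finset.Ico 1 m, analyticOrderNatAt (L j) ρ)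
    (h𝔣0 : 𝔣 0 = ⊤) (hχ0 : ∀ v, χ 0 v = 1)
    (hcond : ∀ j ∈ Finset.Ico 1 m, |(NumberField.discr E : ℝ)| * (Ideal.absNorm (𝔣 j) : ℝ) ≤ (NumberField.discr N).natAbs)
    (hdE : ((NumberField.discr E).natAbs : ℝ) ≤ (NumberField.discr N).natAbs)
    {θ : ℝ} (hθ0 : 0 < θ) (hθb : θ * b ≤ 1 / 8) (hθ1 : θ ≤ 1 / 8) {x η : ℝ} (hx1 : 1 < x)
    (haθ : a * Real.log (ThornerZaman.condQn N) ≤ θ * Real.log x) (h2θ : 2 ≤ θ * Real.log x)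
    (hη0 : 0 < η) (hη1 : η ≤ Real.log 2) (hηx : Real.exp (-(θ / 8) * Real.log x) ≤ 2 * η)
    {lo hi : ℝ} (hlo : Real.log x ≤ lo) (hlohi : lo < hi) (hhi : hi ≤ Real.log x + η)
    {ε₀ : ℝ} (hε₀0 : 0 < ε₀) (hε₀1 : ε₀ ≤ 1 / 4) {κ c₁ : ℝ}
    (hjunk : (n₀ : ℝ) * ((338 * (512 * ((n₀ : ℝ) + 1)) + 96 * (M / (4 * ε₀)) * (512 * ((n₀ : ℝ) + 1)) *
      (4 * tailConst₁ + tailConst₂) + 108 + 640 * leftLineConst * (max Al Cr) * (M / (4 * ε₀))) *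
      ThornerZaman.condQn N ^ (7 : ℕ) * (Real.log x + 1) * Real.exp (-(θ / 4) * Real.log x)) ≤
      κ * c₁ / 2 * ThornerZaman.condQn N ^ (-(2 : ℝ)))
    (hzfr : ∀ (ψ : AddChar (Additive (ClassGroup (𝓞 N))) ℂ) (ρ : ℂ), famF N ψ ρ = 0 → 1 / 4 ≤ ρ.re →
        ρ.re < 1 → |ρ.im| ≤ Real.exp (θ * (hi + ε₀ * η)) → ¬ excRegion c N ρ →
          ρ.re ≤ 1 - cZ / (a * Real.log (ThornerZaman.condQn N) + Real.log (|ρ.im| + 4)))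
    (cc : ℂ) (hcc : ‖cc‖ ≤ 1) (Exc : ℕ → Finset ℂ)
    (hExc0 : ∀ ρ ∈ Exc 0, famF E 0 ρ = 0 ∧ 0 < ρ.re ∧ ρ.re < 1)
    (hExcj : ∀ j ∈ Finset.Ico 1 m, ∀ ρ ∈ Exc j, L j ρ = 0 ∧ 0 < ρ.re ∧ ρ.re < 1)
    (hExc' : ∀ ρ, dedekindZeta₁ N ρ = 0 → 0 < ρ.re → ρ.re < 1 → excRegion c N ρ →
        (famF E 0 ρ = 0 → ρ ∈ Exc 0) ∧ ∀ j ∈ Finset.Ico 1 m, L j ρ = 0 → ρ ∈ Exc j) :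
    ‖∑ j ∈ Finset.range m, cc ^ j * coefFordK (rcCoef (𝔣 j) (χ j)) (windowTest lo hi (ε₀ * η)) 0 -
        fordLaplace (windowTest lo hi (ε₀ * η)) (-1) +
        (∑ ρ ∈ Exc 0, (famMult E 0 ρ : ℂ) * fordLaplace (windowTest lo hi (ε₀ * η)) (-ρ) +
          ∑ j ∈ Finset.Ico 1 m, cc ^ j *
            ∑ ρ ∈ Exc j, (analyticOrderNatAt (L j) ρ : ℂ) * fordLaplace (windowTest lo hi (ε₀ * η)) (-ρ))‖ ≤
      ((n₀ : ℝ) * (9 / 2 * (2 * Real.exp 1 * D * Real.exp (-(cZ / (6 * θ))))) +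
        κ * c₁ / 2 * ThornerZaman.condQn N ^ (-(2 : ℝ))) * x * η := by
  classical
  obtain ⟨hc₁16, hc₂0⟩ := tailConst_nonneg
  have hlC := leftLineConst_nonneg
  have hM0 : 0 ≤ M := by linarith
  have hAC0 : 0 < max Al Cr := lt_max_of_lt_left hAl0
  have hN : 1 < Module.finrank ℚ N := by rw [hNn]; exact hn₀
  have hn0 : (0 : ℝ) < n₀ := by exact_mod_cast (lt_trans Nat.zero_lt_one hn₀)
  have hQ12 : (12 : ℝ) ≤ ThornerZaman.condQn N := ThornerZaman.twelve_le_condQn (K := N) hN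
  have hmn₀ : (m : ℝ) ≤ n₀ := by
    have : m ≤ n₀ := by rw [← hNn, hdeg]; exact Nat.le_mul_of_pos_left m Module.finrank_pos
    exact_mod_cast this
  have hm0 : (0 : ℝ) ≤ m := Nat.cast_nonneg _
  have hnEn₀ : (Module.finrank ℚ E : ℝ) ≤ n₀ := by
    have : Module.finrank ℚ E ≤ n₀ := by rw [← hNn, hdeg]; exact Nat.le_mul_of_pos_right _ hm1
    exact_mod_cast this
  have hx0 : 0 < x := by linarith
  have hL0 : 0 < Real.log x := Real.log_pos hx1
  have hxexp : Real.exp (Real.log x) = x := Real.exp_log hx0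
  set ε : ℝ := ε₀ * η with hε
  have hε0 : 0 < ε := by positivity
  have hε4 : ε ≤ η / 4 := by
    rw [hε]; have := mul_le_mul_of_nonneg_right hε₀1 hη0.le; linarith
  have hθL8 : θ * Real.log x ≤ Real.log x / 8 := by
    have := mul_le_mul_of_nonneg_right hθ1 hL0.le; linarith
  have hlog2 : Real.log 2 < 0.6931471808 := Real.log_two_lt_d9
  have hεlo : ε < lo := by linarith
  have hLX0 : 0 ≤ hi + ε := by linarith
  have hT₁1 : 1 ≤ Real.exp (θ * (hi + ε)) := Real.one_le_exp (mul_nonneg hθ0.le hLX0)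
  have hrange : Real.exp (b * (a * Real.log (ThornerZaman.condQn N) + Real.log (Real.exp (θ * (hi + ε)) + 4))) ≤
      Real.exp (hi + ε) ^ ((1 : ℝ) / 2) :=
    frobWindow_range (LX := hi + ε) hb hθ0 hθb hθ1 haθ h2θ hlo hlohi hε0 rfl rfl
  have hnQ : ((n₀ : ℕ) : ℝ) ≤ ThornerZaman.condQn N := by
    rw [← hNn]; exact ThornerZaman.finrank_le_condQn (K := N)
  have hhK : (NumberField.classNumber N : ℝ) ≤ ThornerZaman.condQn N ^ (4 : ℕ) :=
    ThornerZaman.classNumber_le_condQn_pow (K := N) hN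
  have hhK1 : (1 : ℝ) ≤ NumberField.classNumber N := by exact_mod_cast one_le_classNumber (K := N)
  have hAK4 : Real.log ((NumberField.discr N).natAbs : ℝ) + 3 * ((n₀ : ℕ) : ℝ) ≤ 4 * ThornerZaman.condQn N := by
    rw [← hNn]; exact windowConst_le_condQn N
  have hlogd0 : 0 ≤ Real.log ((NumberField.discr N).natAbs : ℝ) := Real.log_natCast_nonneg _
  have h := frobWindow_core_zfr n₀ hn₀ hb hD ha c hcZ hAl0 hAl hCr0 hCr hM E N hNn hdens m hm1 𝔣 χ p L L' hdata
    hnt hL hL' hord h𝔣0 hχ0 hcond hdE hnEn₀ hε0 hεlo hlohi hT₁1 hzfr hrange cc hcc Exc hExc0 hExcj hExc'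
  rw [hNn] at h
  have hbook := frobWindow_bookkeeping (W₀ := 512 * (((n₀ : ℕ) : ℝ) + 1)) (A_L := max Al Cr)
    (AK := Real.log ((NumberField.discr N).natAbs : ℝ) + 3 * ((n₀ : ℕ) : ℝ))
    (hK := (NumberField.classNumber N : ℝ)) (κ₁ := 2 * Real.exp 1 * D * Real.exp (-(cZ / (6 * θ))))
    (κ₂ := (338 * (512 * ((n₀ : ℝ) + 1)) + 96 * (M / (4 * ε₀)) * (512 * ((n₀ : ℝ) + 1)) * (4 * tailConst₁ + tailConst₂) + 108 +
      640 * leftLineConst * (max Al Cr) * (M / (4 * ε₀))) * ThornerZaman.condQn N ^ (7 : ℕ) * (Real.log x + 1) *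
      Real.exp (-(θ / 4) * Real.log x))
    (L := Real.log x) (ℓ := hi - lo + 2 * ε) (LX := hi + ε) (X := Real.exp (hi + ε)) (T₁ := Real.exp (θ * (hi + ε)))
    hQ12 hM1 hAC0 (by positivity) hlC hc₁16 hc₂0 hD hcZ ha hhK (Nat.cast_nonneg _) rfl hAK4 hlogd0 hnQ
    (Nat.cast_nonneg _) hθ0 hθ1 le_rfl haθ h2θ hη0 hη1 hηx hε₀0 hε₀1 le_rfl hlo hlohi hhi
    hε rfl rfl rfl rfl
  rw [hxexp] at hbook
  have hℓ0 : 0 ≤ hi - lo + 2 * ε := by linarith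
  refine h.trans (core_glue_le hm0 hmn₀ hhK1 ?_ ?_ hbook ?_)
  · refine mul_nonneg (Real.exp_pos _).le (add_nonneg (add_nonneg ?_ ?_) ?_)
    · exact mul_nonneg hℓ0 (by positivity)
    · have h5 : 0 ≤ Real.log (Real.exp (θ * (hi + ε)) + 5) :=
        Real.log_nonneg (by linarith [Real.exp_pos (θ * (hi + ε))])
      have hAK0 : 0 ≤ Real.log ((NumberField.discr N).natAbs : ℝ) + 3 * ((n₀ : ℕ) : ℝ) := by positivity
      exact mul_nonneg (mul_nonneg hℓ0 (by positivity)) (mul_nonneg (by positivity)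
        (mul_nonneg (by positivity) (mul_nonneg (by positivity) (add_nonneg hAK0 h5))))
    · positivity
  · exact add_nonneg (mul_nonneg (by positivity) hℓ0) (by positivity)
  · -- `n₀ (9/2 κ₁ + κ₂) ≤ n₀ (9/2) κ₁ + κc₁Q^{−2}/2`
    have e : (n₀ : ℝ) * (9 / 2 * (2 * Real.exp 1 * D * Real.exp (-(cZ / (6 * θ)))) +
        (338 * (512 * ((n₀ : ℝ) + 1)) + 96 * (M / (4 * ε₀)) * (512 * ((n₀ : ℝ) + 1)) * (4 * tailConst₁ + tailConst₂) + 108 +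
          640 * leftLineConst * (max Al Cr) * (M / (4 * ε₀))) * ThornerZaman.condQn N ^ (7 : ℕ) * (Real.log x + 1) *
          Real.exp (-(θ / 4) * Real.log x)) =
        (n₀ : ℝ) * (9 / 2 * (2 * Real.exp 1 * D * Real.exp (-(cZ / (6 * θ))))) +
        (n₀ : ℝ) * ((338 * (512 * ((n₀ : ℝ) + 1)) + 96 * (M / (4 * ε₀)) * (512 * ((n₀ : ℝ) + 1)) *
          (4 * tailConst₁ + tailConst₂) + 108 + 640 * leftLineConst * (max Al Cr) * (M / (4 * ε₀))) *
          ThornerZaman.condQn N ^ (7 : ℕ) * (Real.log x + 1) * Real.exp (-(θ / 4) * Real.log x)) := by ring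
    rw [e]
    have hsum : (n₀ : ℝ) * (9 / 2 * (2 * Real.exp 1 * D * Real.exp (-(cZ / (6 * θ))))) +
        (n₀ : ℝ) * ((338 * (512 * ((n₀ : ℝ) + 1)) + 96 * (M / (4 * ε₀)) * (512 * ((n₀ : ℝ) + 1)) *
          (4 * tailConst₁ + tailConst₂) + 108 + 640 * leftLineConst * (max Al Cr) * (M / (4 * ε₀))) *
          ThornerZaman.condQn N ^ (7 : ℕ) * (Real.log x + 1) * Real.exp (-(θ / 4) * Real.log x)) ≤
        (n₀ : ℝ) * (9 / 2 * (2 * Real.exp 1 * D * Real.exp (-(cZ / (6 * θ))))) +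
        κ * c₁ / 2 * ThornerZaman.condQn N ^ (-(2 : ℝ)) := by linarith [hjunk]
    exact mul_le_mul_of_nonneg_right (mul_le_mul_of_nonneg_right hsum hx0.le) hη0.le

/-- **The exceptional sets of a unique simple real zero.**  If every zero of `ζ₁_N` on the exceptional segment
equals `β₁` (`0 < β₁ < 1`), the sets `Exc 0 = {β₁ : ζ₁_E(β₁) = 0}`, `Exc j = {β₁ : L_j(β₁) = 0}` are admissible
exceptional sets, and the correction term against any weight is `(m_E(β₁) + Σ_j c^j m_j(β₁)) F(−β₁)`. -/
theorem excSets_of_unique_zero {E N : Type} [Field E] [NumberField E] [Field N] [NumberField N] {m : ℕ}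
    (L : ℕ → ℂ → ℂ) (hL : ∀ j ∈ Finset.Ico 1 m, Differentiable ℂ (L j)) {β₁ c : ℝ} (hβ0 : 0 < β₁) (hβ1 : β₁ < 1)
    (huniq : ∀ ρ, dedekindZeta₁ N ρ = 0 → 0 < ρ.re → ρ.re < 1 → excRegion c N ρ → ρ = β₁) :
    ∃ Exc : ℕ → Finset ℂ,
      (∀ ρ ∈ Exc 0, famF E 0 ρ = 0 ∧ 0 < ρ.re ∧ ρ.re < 1) ∧
      (∀ j ∈ Finset.Ico 1 m, ∀ ρ ∈ Exc j, L j ρ = 0 ∧ 0 < ρ.re ∧ ρ.re < 1) ∧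
      (∀ ρ, dedekindZeta₁ N ρ = 0 → 0 < ρ.re → ρ.re < 1 → excRegion c N ρ →
        (famF E 0 ρ = 0 → ρ ∈ Exc 0) ∧ ∀ j ∈ Finset.Ico 1 m, L j ρ = 0 → ρ ∈ Exc j) ∧
      (∀ (cc : ℂ) (gg : ℝ → ℝ),
        ∑ ρ ∈ Exc 0, (famMult E 0 ρ : ℂ) * fordLaplace gg (-ρ) +
          ∑ j ∈ Finset.Ico 1 m, cc ^ j * ∑ ρ ∈ Exc j, (analyticOrderNatAt (L j) ρ : ℂ) * fordLaplace gg (-ρ) =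
        ((analyticOrderNatAt (dedekindZeta₁ E) β₁ : ℂ) +
          ∑ j ∈ Finset.Ico 1 m, cc ^ j * (analyticOrderNatAt (L j) β₁ : ℂ)) * fordLaplace gg (-(β₁ : ℂ))) := by
  classical
  set Exc : ℕ → Finset ℂ := fun j ↦
    if j = 0 then (if dedekindZeta₁ E β₁ = 0 then {(β₁ : ℂ)} else ∅)
    else (if L j β₁ = 0 then {(β₁ : ℂ)} else ∅) with hExcdef
  refine ⟨Exc, ?_, ?_, ?_, ?_⟩
  · intro ρ hρ
    rw [hExcdef] at hρ; dsimp only at hρ; rw [if_pos rfl] at hρ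
    split_ifs at hρ with h0
    · rw [Finset.mem_singleton] at hρ; subst hρ
      exact ⟨by rw [famF_zero]; exact h0, by rw [Complex.ofReal_re]; exact hβ0, by rw [Complex.ofReal_re]; exact hβ1⟩
    · simp at hρ
  · intro j hj ρ hρ
    have hj0 : j ≠ 0 := by rw [Finset.mem_Ico] at hj; omega
    rw [hExcdef] at hρ; dsimp only at hρ; rw [if_neg hj0] at hρ
    split_ifs at hρ with h0
    · rw [Finset.mem_singleton] at hρ; subst hρ
      exact ⟨h0, by rw [Complex.ofReal_re]; exact hβ0, by rw [Complex.ofReal_re]; exact hβ1⟩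
    · simp at hρ
  · intro ρ h0 h1 h2 hexc
    have hρρ := huniq ρ h0 h1 h2 hexc
    subst hρρ
    refine ⟨fun hE0 ↦ ?_, fun j hj hj0 ↦ ?_⟩
    · rw [famF_zero] at hE0
      rw [hExcdef]; dsimp only; rw [if_pos rfl, if_pos hE0, Finset.mem_singleton]
    · have hjne : j ≠ 0 := by rw [Finset.mem_Ico] at hj; omega
      rw [hExcdef]; dsimp only; rw [if_neg hjne, if_pos hj0, Finset.mem_singleton]
  · intro cc gg
    have h0 : ∑ ρ ∈ Exc 0, (famMult E 0 ρ : ℂ) * fordLaplace gg (-ρ) =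
        (analyticOrderNatAt (dedekindZeta₁ E) β₁ : ℂ) * fordLaplace gg (-(β₁ : ℂ)) := by
      rw [hExcdef]; dsimp only; rw [if_pos rfl]; simp only [famMult, famF_zero]
      exact sum_excSingleton_eq (dedekindZeta₁_differentiable E) (β₁ : ℂ) (fun ρ ↦ fordLaplace gg (-ρ))
    have hj : ∀ j ∈ Finset.Ico 1 m, ∑ ρ ∈ Exc j, (analyticOrderNatAt (L j) ρ : ℂ) * fordLaplace gg (-ρ) =
        (analyticOrderNatAt (L j) β₁ : ℂ) * fordLaplace gg (-(β₁ : ℂ)) := by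
      intro j hj
      have hjne : j ≠ 0 := by rw [Finset.mem_Ico] at hj; omega
      rw [hExcdef]; dsimp only; rw [if_neg hjne]
      exact sum_excSingleton_eq (hL j hj) (β₁ : ℂ) (fun ρ ↦ fordLaplace gg (-ρ))
    rw [h0, Finset.sum_congr rfl (fun j hj' ↦ by rw [hj j hj']), add_mul, Finset.sum_mul]
    refine congrArg _ (Finset.sum_congr rfl fun j _ ↦ by ring)

/-- `Q⁴ x^{−θ/8} ≤ 1` once `Q^{32/θ} ≤ x` (`Q, x, θ > 0`). -/
theorem pow_four_mul_rpow_le_one {Q x θ : ℝ} (hQ0 : 0 < Q) (hx0 : 0 < x) (hθ0 : 0 < θ) (hx32 : Q ^ (32 / θ) ≤ x) :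
    Q ^ (4 : ℕ) * x ^ (-(θ / 8)) ≤ 1 := by
  have h1 := Real.log_le_log (by positivity) hx32
  rw [Real.log_rpow hQ0] at h1
  have h2 : (Q ^ (4 : ℕ) : ℝ) = Real.exp (4 * Real.log Q) := by
    rw [← Real.rpow_natCast, Real.rpow_def_of_pos hQ0]; push_cast; ring_nf
  have h3 : x ^ (-(θ / 8)) = Real.exp (-(θ / 8) * Real.log x) := by rw [Real.rpow_def_of_pos hx0]; ring_nf
  rw [h2, h3, ← Real.exp_add]
  have h4 : 4 * Real.log Q ≤ θ / 8 * Real.log x := by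
    have := mul_le_mul_of_nonneg_left h1 hθ0.le
    have e : θ * (32 / θ * Real.log Q) = 32 * Real.log Q := by field_simp
    linarith
  exact Real.exp_le_one_iff.mpr (by linarith)

/-- `1/2 ≤ β₁` for `β₁` in the window of constant `c ≤ 1/(8(n₀²+1))`. -/
theorem half_le_of_window {N : Type} [Field N] [NumberField N] {n₀ : ℕ} {c β₁ : ℝ}
    (hcn : c ≤ 1 / (8 * ((n₀ : ℝ) ^ 2 + 1)))
    (hwin : 1 - c / (Real.log ((NumberField.discr N).natAbs : ℝ) + Real.log 4) < β₁) : 1 / 2 ≤ β₁ := by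
  have hlogd0 : 0 ≤ Real.log ((NumberField.discr N).natAbs : ℝ) := Real.log_natCast_nonneg _
  have hlog4' : 1 < Real.log 4 := by
    rw [show (4:ℝ) = 2 ^ 2 by norm_num, Real.log_pow]; have := Real.log_two_gt_d9; push_cast; linarith
  have hc2 : c ≤ 1 / 2 := by
    refine hcn.trans ?_
    rw [div_le_div_iff_of_pos_left one_pos (by positivity) (by norm_num)]
    have : (0 : ℝ) ≤ (n₀ : ℝ) ^ 2 := sq_nonneg _
    linarith
  have hden : 1 ≤ Real.log ((NumberField.discr N).natAbs : ℝ) + Real.log 4 := by linarith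
  have : c / (Real.log ((NumberField.discr N).natAbs : ℝ) + Real.log 4) ≤ 1 / 2 := by
    rw [div_le_iff₀ (by linarith)]
    have := mul_le_mul hc2 hden zero_le_one (by norm_num)
    linarith
  linarith

/-- The classical zero-free region off the exceptional segment in `Q`-form, from clause (1) of the Landau–Page
package with constant `c` (any height bound `T`). -/
theorem zfr_classical_of_pack {N : Type} [Field N] [NumberField N] {c a : ℝ} (hc : 0 < c) (ha : 1 ≤ a)
    (hpack : ∀ (χ : ClassGroup (𝓞 N) →* ℂˣ) (ρ : ℂ),
      (((χ = 1 → dedekindZeta₁ N ρ = 0) ∧ (χ ≠ 1 → classGroupLFunction₀ N χ ρ = 0)) ∧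
        1 - c / (Real.log ((NumberField.discr N).natAbs : ℝ) + Real.log (|ρ.im| + 4)) < ρ.re) →
        ρ.im = 0 ∧ χ * χ = 1) {T : ℝ} :
    ∀ (ψ : AddChar (Additive (ClassGroup (𝓞 N))) ℂ) (ρ : ℂ), famF N ψ ρ = 0 →
      1 / 4 ≤ ρ.re → ρ.re < 1 → |ρ.im| ≤ T → ¬ excRegion c N ρ →
        ρ.re ≤ 1 - c / (a * Real.log (ThornerZaman.condQn N) + Real.log (|ρ.im| + 4)) := by
  intro ψ ρ h0 _ _ _ hexc
  have h1 := re_le_of_not_excRegion hpack ψ h0 hexc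
  have hK : 0 ≤ Real.log (ThornerZaman.condQn N) := by
    have hd := natAbs_discr_le_condQn N
    have : (1 : ℝ) ≤ ((NumberField.discr N).natAbs : ℝ) := by
      exact_mod_cast Nat.one_le_iff_ne_zero.2 (Int.natAbs_ne_zero.2 (NumberField.discr_ne_zero N))
    exact Real.log_nonneg (by linarith)
  have hdQ : Real.log ((NumberField.discr N).natAbs : ℝ) ≤ a * Real.log (ThornerZaman.condQn N) := by
    have hd0 : (0 : ℝ) < ((NumberField.discr N).natAbs : ℝ) := by
      exact_mod_cast Nat.pos_of_ne_zero (Int.natAbs_ne_zero.2 (NumberField.discr_ne_zero N))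
    have h2 := Real.log_le_log hd0 (natAbs_discr_le_condQn N)
    nlinarith
  have hlog4' : 0 < Real.log (|ρ.im| + 4) := Real.log_pos (by linarith [abs_nonneg ρ.im])
  have hlogd : 0 ≤ Real.log ((NumberField.discr N).natAbs : ℝ) := Real.log_natCast_nonneg _
  have : c / (a * Real.log (ThornerZaman.condQn N) + Real.log (|ρ.im| + 4)) ≤
      c / (Real.log ((NumberField.discr N).natAbs : ℝ) + Real.log (|ρ.im| + 4)) :=
    div_le_div_of_nonneg_left hc.le (by linarith) (by linarith)
  linarith

end Summit.QuantumAdvantage.QuantumAdvantage.Theorems.DegreeOnePrimesEscape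

end
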